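import Summits.CriticalPhenomena.PercolationContinuityZ3.Theorems.PercNearOneGluingNoHeavyRsw3SlabSpanningClusters
import Literature.Probability.Percolation.Aizenman1997SpanningClusters
import HarnessLib

/-!
# Discharge of the named published statement `Aizenman1997TwoSpanningClustersZ3` (Aizenman 1997, Thm. 2, `d = 3`)

builds on p205010 (kernel theorem, internal audit signed; external expert review pending)

RSW3 lane (LANE 3), seat `prim-rsw3-p2` (gen 3). Helper file for the crux `stmt-CriticalPhenomena-4575` (`--supports`).
No definitions, no sorries.  The Literature statement `Literature.Probability.Percolation.Aizenman1997TwoSpanningClustersZ3`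
(`Literature/Probability/Percolation/Aizenman1997SpanningClusters.lean`: at `p_c(ℤ³)`, thin slab-boxes `{0..n}×{0..M}²`,
`M ≥ K n`, contain two spanning open paths not joined inside the box with probability `≥ c > 0`, uniformly in `n`) is
PROVED by the lane's kernel theorem `Rsw3.aizenman_twoSpanningClusters_criticalProbI` (p213321), with
`c = (KestenZhang.critTwoArmsDelta 2)^{49}/2`.

References: M. Aizenman, Nucl. Phys. B 485 (1997) 551–582, §2 Thm. 2 [Aizenman1997].
-/

noncomputable section

namespace Summit.CriticalPhenomena.PercolationContinuityZ3.Theorems.Rsw3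

open MeasureTheory Literature.Probability.LatticeModels Literature.Probability.Percolation
open Literature.Probability.Percolation.KestenZhang

/-- **Aizenman's Theorem 2 holds for bond percolation on `ℤ³`** (discharge of the named statement
`Literature.Probability.Percolation.Aizenman1997TwoSpanningClustersZ3`): from
`Rsw3.aizenman_twoSpanningClusters_criticalProbI` with `c = (KestenZhang.critTwoArmsDelta 2)^{49}/2`.
builds on p205010 (kernel theorem, internal audit signed; external expert review pending). [cite: Aizenman1997, §2 Thm. 2] -/
theorem Aizenman1997TwoSpanningClustersZ3_holds : Aizenman1997TwoSpanningClustersZ3 := by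
  obtain ⟨K, hK⟩ := aizenman_twoSpanningClusters_criticalProbI
  have hδ : 0 < critTwoArmsDelta 2 ^ 49 / 2 := by
    have := critTwoArmsDelta_pos 2; positivity
  exact ⟨critTwoArmsDelta 2 ^ 49 / 2, hδ, K, fun n hn M hM => (hK n hn M hM).le⟩

end Summit.CriticalPhenomena.PercolationContinuityZ3.Theorems.Rsw3

end
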